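import Summits.Ventures.HSemireg.Pad4FirstOrderModelUnfedFlag

/-!
# Venture HSemireg — THEOREM L^ζ step (L1), demand side: the `w_{ζ_f}`-image of the demand `ob_κ(X)` on a pair of
# factors (companion of `Pad4FirstOrderModel.lean`, row 716; TIER-2 step S1, director-hodge g9 «S1 ONLY un-gated», cell INBOX l.30919)

HONEST FRAMING. PROVED bookkeeping identities of the first-order MODEL of the PAD-4 anchor (seat s4-prove-1 g23, TRACK S4-PUSH
lane (ii), 2026-08-27). `TheoremLZetaMain` ∕ `TheoremLZeta` of `Pad4FirstOrderModel.lean` (p505821) stay kernel-OPEN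
(`@[conjecture]`); nothing here proves them. WHAT IS PROVED: the pencil step (L1) of PAD4-THEOREM-L v1.2 66fb170a6cb906b7 §2 ∕
§5 (P2) on the DEMAND side, for an ARBITRARY constituent `X`, an arbitrary `κ ∈ T_W ≅ M₄(ℂ)` and any two factors `σ ≠ f`:
reading the `V_σ ⊗ V_f`-block of `ob_κ(X) = Σ_g c_g ξ̄_{ζ_g} ∧ κ(ξ_{ζ_g})` (closed form `ob_qPair`, row 739) MODULO
`V_σ ⊗ Ξ_{ζ_f}`, i.e. applying the model's functional `w_{ζ_f}(a ē_A + b ē_B) = b − ζ̄_f a` on the `f`-index, kills the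
`c_f`-term (its `f`-factor is `ξ̄_{ζ_f}`, and `w_{ζ_f}(ξ̄_{ζ_f}) = 0`) and leaves `± c_σ · ξ̄_{ζ_σ}(o_σ) · w_{ζ_f}(κ(ξ_{ζ_σ})_f)`
(`ob_qPair_wImage`); at the Weil direction `κ₀ = E_{fσ}` (`k_{fσ} = 1`) this is `± c_σ · ξ̄_{ζ_σ}(o_σ)` (`ob_qPair_wImage_E`),
non-zero at `o_σ = ē_A` exactly when `X` is charged on `σ` (`ob_qPair_wImage_E_ne_zero`) — the pencil's «the element
`(κ ∪ c₁X)^{0,2}` has, modulo `V_σ ⊗ Ξ_f`, the `V_σ ⊗ V_f`-part `a·ξ̄_σ ⊗ [κ(ξ_σ)_f]`, non-zero for some `κ ∈ T_W`».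
WHY THE QUOTIENT AND NOT A COORDINATE: the single coordinate `ē_{A,σ} ⊗ ē_{B,f}` of `ob_{κ₀}(X)` reads `±(c_σ − c_f)` and
vanishes when `c_σ = c_f`; the quotient by `Ξ_{ζ_f}` is the invariant the (L1) ∕ (R1) rows of the pencil proof use (the
partners on `f` feed only `Ξ_{ζ_f}`, evaluation pairing `coef_neg_one_pos_self`). The CONTRIBUTOR half of (L1) («only the
σ-ray partners of `X` feed this class») is NOT in this file. No variety, sheaf or semiregularity map is constructed; nothing
here says HC ∕ HC_CM ∕ HC_AV holds; no fact, no definition, no instance, no notation. REUSE (typer g7, l.30700): `ob_qPair`,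
`qPair_comm` (row 739), `zetaC`∕`zetaBar`∕`xiBar`∕`kap` (row 716). Sizing note: HOME∕s4push∕prove-1∕
TIER2-SIZING-TheoremLZetaMain-prove-1-g23.md b15810b30240e11e §2 S1. Typed ≠ proved ≠ endorsed.
-/

noncomputable section
namespace Summit.Ventures.HSemireg.Pad4FirstOrder
open Finset

/-! ## `w_ζ` kills `ξ̄_ζ`; `ζ̄ ζ = 1` -/

/-- `ζ = i^k ≠ 0`. -/
theorem zetaC_ne_zero (k : Fin 4) : zetaC k ≠ 0 := pow_ne_zero _ Complex.I_ne_zero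

/-- `ζ̄ · ζ = 1` (`zetaBar k = (zetaC k)⁻¹`). -/
theorem zetaBar_mul_zetaC (k : Fin 4) : zetaBar k * zetaC k = 1 := inv_mul_cancel₀ (zetaC_ne_zero k)

/-- `w_ζ(ξ̄_ζ) = 0` in coordinates: `ξ̄_ζ(ē_B) − ζ̄ · ξ̄_ζ(ē_A) = ζ̄ − ζ̄ = 0`. -/
theorem xiBar_B_sub_zetaBar_mul_xiBar_A (k : Fin 4) : xiBar k (1, 0) - zetaBar k * xiBar k (0, 0) = 0 := by
  simp [xiBar]

/-! ## The `w_{ζ_f}`-image of the demand on the pair `(σ, f)` -/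

/-- **(L1), demand side, general `κ`.** For `σ ≠ f` and any base index `o`, the `w_{ζ_f}`-image (on the `f`-index) of the
`V_σ ⊗ V_f`-block of `ob_κ(X)`:
`ob(qPair σ f, o[f ↦ ē_B]) − ζ̄_f · ob(qPair σ f, o[f ↦ ē_A]) = ± c_σ · ξ̄_{ζ_σ}(o σ) · (κ_{fσ} − ζ̄_f ζ_σ κ_{σf})`,
sign `+` for `σ < f`, `−` for `f < σ` (the orientation `u ∧ v ↦ u ⊗ v` of the model); the bracket is
`w_{ζ_f}(κ(ξ_{ζ_σ})_f)` with `κ(ξ_ζ^{(σ)})_f = ζ_σ κ_{σf} ē_A + κ_{fσ} ē_B`. The `c_f`-term of `ob_qPair` drops out. -/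
theorem ob_qPair_wImage (X : Constituent) (κ : Matrix (Fin 4) (Fin 4) ℂ) (σ f : Fin 4) (hσf : σ ≠ f)
    (o : Fin 4 → ℕ × ℕ) :
    ob X κ (qPair σ f) (Function.update o f (1, 0)) - zetaBar (X.phase f) * ob X κ (qPair σ f) (Function.update o f (0, 0)) =
      (if σ < f then 1 else -1) * ((X.charge σ : ℂ) * xiBar (X.phase σ) (o σ) *
        (κ f σ - zetaBar (X.phase f) * zetaC (X.phase σ) * κ σ f)) := by
  rcases lt_or_gt_of_ne hσf with hlt | hgt
  · rw [ob_qPair X κ σ f hlt, ob_qPair X κ σ f hlt, if_pos hlt]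
    simp only [Function.update_self, Function.update_of_ne hσf, kap, xiBar, if_true,
      show ((1:ℕ), (0:ℕ)) ≠ (0, 0) from by decide, if_false]
    ring
  · rw [qPair_comm σ f, ob_qPair X κ f σ hgt, ob_qPair X κ f σ hgt, if_neg (not_lt.mpr (le_of_lt hgt))]
    simp only [Function.update_self, Function.update_of_ne hσf, kap, xiBar, if_true,
      show ((1:ℕ), (0:ℕ)) ≠ (0, 0) from by decide, if_false]
    ring

/-! ## The Weil direction `κ₀ = E_{fσ}` -/

/-- **(L1), demand side, at `κ₀ = E_{fσ}`** (`k_{fσ} = 1`, all other entries `0`; the matrix literal is the one of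
`lowerColumn_unsolvable_unfedFlag`, row 739): the `w_{ζ_f}`-image of the `V_σ ⊗ V_f`-block of `ob_{κ₀}(X)` is
`± c_σ · ξ̄_{ζ_σ}(o σ)` — the pencil's `a · ξ̄_σ ⊗ [κ₀(ξ_σ)_f mod Ξ_f]` with `w_{ζ_f}(κ₀(ξ_σ)_f) = w_{ζ_f}(ē_B) = 1`. -/
theorem ob_qPair_wImage_E (X : Constituent) (σ f : Fin 4) (hσf : σ ≠ f) (o : Fin 4 → ℕ × ℕ) :
    ob X (Matrix.of fun a b => if a = f ∧ b = σ then (1 : ℂ) else 0) (qPair σ f) (Function.update o f (1, 0)) -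
        zetaBar (X.phase f) *
          ob X (Matrix.of fun a b => if a = f ∧ b = σ then (1 : ℂ) else 0) (qPair σ f) (Function.update o f (0, 0)) =
      (if σ < f then 1 else -1) * ((X.charge σ : ℂ) * xiBar (X.phase σ) (o σ)) := by
  rw [ob_qPair_wImage X _ σ f hσf o]
  simp [Matrix.of_apply, hσf]

/-- … read at `o σ = ē_A` (`ξ̄_{ζ_σ}(ē_A) = 1`): the value is `± c_σ`. -/
theorem ob_qPair_wImage_E_A (X : Constituent) (σ f : Fin 4) (hσf : σ ≠ f) (o : Fin 4 → ℕ × ℕ) (ho : o σ = (0, 0)) :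
    ob X (Matrix.of fun a b => if a = f ∧ b = σ then (1 : ℂ) else 0) (qPair σ f) (Function.update o f (1, 0)) -
        zetaBar (X.phase f) *
          ob X (Matrix.of fun a b => if a = f ∧ b = σ then (1 : ℂ) else 0) (qPair σ f) (Function.update o f (0, 0)) =
      (if σ < f then 1 else -1) * (X.charge σ : ℂ) := by
  rw [ob_qPair_wImage_E X σ f hσf o, ho]
  simp [xiBar]

/-- **Hence the `w_{ζ_f}`-image of the demand at `κ₀ = E_{fσ}` is NON-ZERO iff `X` is charged on `σ`** — for EVERY charge
`c_f` (including `c_f = c_σ`, where the single coordinate `ē_{A,σ} ⊗ ē_{B,f}` of `ob_{κ₀}(X)` vanishes). This is the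
(L1) input of THEOREM L^ζ's column argument: something must feed this class, and (contributor half, not in this file)
only σ-ray partners of `X` can. -/
theorem ob_qPair_wImage_E_ne_zero (X : Constituent) (σ f : Fin 4) (hσf : σ ≠ f) (hσ : X.charge σ ≠ 0)
    (o : Fin 4 → ℕ × ℕ) (ho : o σ = (0, 0)) :
    ob X (Matrix.of fun a b => if a = f ∧ b = σ then (1 : ℂ) else 0) (qPair σ f) (Function.update o f (1, 0)) -
        zetaBar (X.phase f) *
          ob X (Matrix.of fun a b => if a = f ∧ b = σ then (1 : ℂ) else 0) (qPair σ f) (Function.update o f (0, 0)) ≠ 0 := by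
  rw [ob_qPair_wImage_E_A X σ f hσf o ho]
  refine mul_ne_zero ?_ (Nat.cast_ne_zero.mpr hσ)
  split <;> norm_num

/-- Conversely, if `X` is uncharged on `σ` the `w_{ζ_f}`-image vanishes at EVERY `κ` (the class `ξ̄_σ ⊗ W_f` is not
demanded): the `σ`-charge is exactly what the (L1) row detects. -/
theorem ob_qPair_wImage_eq_zero_of_uncharged (X : Constituent) (κ : Matrix (Fin 4) (Fin 4) ℂ) (σ f : Fin 4)
    (hσf : σ ≠ f) (hσ : X.charge σ = 0) (o : Fin 4 → ℕ × ℕ) :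
    ob X κ (qPair σ f) (Function.update o f (1, 0)) - zetaBar (X.phase f) * ob X κ (qPair σ f) (Function.update o f (0, 0)) =
      0 := by
  rw [ob_qPair_wImage X κ σ f hσf o, hσ]
  simp

end Summit.Ventures.HSemireg.Pad4FirstOrder
end
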